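import Literature.NumberTheory.LFunctions.PoissonTwistedProgression
import Literature.NumberTheory.LFunctions.GcdSumBounds
import Literature.NumberTheory.LFunctions.KloostermanWeilPrimeProofs
import Literature.NumberTheory.LFunctions.KloostermanPrimePowerTools
import Literature.NumberTheory.Sieve.RamanujanSum
import Literature.NumberTheory.Sieve.DivisorBound
import HarnessLib

/-!
# Incomplete Kloosterman sums with a smooth weight (Matomäki–Merikoski, Lemma 3.8), proved

Topic `Literature/NumberTheory/LFunctions`, sub-namespace `MatomakiMerikoski`. Lemma 3.8 of
K. Matomäki, J. Merikoski, *Siegel zeros, twin primes, Goldbach's conjecture, and primes in short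
intervals* (IMRN 2023; arXiv:2112.11412), §3.5: "Let `δ, ε > 0` and `N ≥ 1`. Let `F : ℝ → ℂ` be
a bounded smooth compactly supported function and suppose that for some `δ ∈ (0, 1)` we have
`|F''| ≪ δ⁻²`. Then, for any integers `α, d, e, q, k` with `d, q ≥ 1` and `(eq, d) = 1`, we have
`∑_{n ≡ α (q), (n,d)=1} F(n/N) e_d(k (en)‾) ≪_ε δ⁻¹ d^{1/2+ε} + N(d, k)/(dq)`."
It is the Kloosterman-sum input of their Proposition 2.3 (§5, type I₂ sums). Everything here is
PROVED (theorems only), from the tree's PROVED Weil bound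
(`Literature.NumberTheory.LFunctions.weil_kloosterman_bound_holds`, `KloostermanWeilPrimeProofs.lean`)
and Poisson summation along a progression (`MatomakiMerikoski2023_lemma34_scaled`,
`PoissonTwistedProgression.lean`), following the printed proof:

* `kloostermanSum_zero_left_eq_ramanujanSum`, `norm_ramanujanSum_le_gcd` — the `h = 0` term:
  `S(0, c; d) = c_d(c)` is a Ramanujan sum and `|c_d(n)| ≤ (d, n)` (multiplicativity and the
  prime-power values `c_{p^a}(n) = p^a[p^a ∣ n] − p^{a−1}[p^{a−1} ∣ n]`);
* `norm_completeSum_eq` — the complete sum after Poisson summation is a Kloosterman sum: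
  `|∑_{n (mod dq), n ≡ α (q), (n,d)=1} e_d(c n̄) e_{dq}(hn)| = |S(h q̄, c; d)|` ((3.9) of the source:
  "by the Chinese remainder theorem we can write `n = αd d̄ + βq q̄` …
  `= e_q(hα d̄) S(h q̄, k ē; d)`");
* `norm_kloostermanSum_le_gcd_sqrt` — Weil's bound in the form used:
  `|S(h q̄, c; d)| ≤ τ(d) d^{1/2} (h, d)^{1/2}`;
* `sum_min_const_div_sq_le`, `sum_gcd_mul_min_le` — the analytic sums
  `∑_{1 ≤ m ≤ M} min(A, B/m²) ≤ 3√(AB)` and `∑_{1 ≤ h ≤ H} (h, d) min(A, B/h²) ≤ 3τ(d)√(AB)`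
  ((h, d) ≤ ∑_{e ∣ d, e ∣ h} e, `GcdSumBounds.lean`);
* `MatomakiMerikoski2023_lemma38` — **Lemma 3.8** with explicit constants: for `F` smooth with
  `tsupport F ⊆ [−S, S]`, `|F| ≤ 1`, `|F''| ≤ C/δ²`, `0 < δ`, `N > 0`, `d, q ≥ 1`, `(q, d) = 1`,
  `α ∈ ℤ`, `c ∈ ℤ/d` (the source's `c = k ē`, so that `(d, c) = (d, k)`):
  `|∑_{n ≡ α (q)} F(n/N) 1_{(n,d)=1} e_d(c n̄)| ≤ 2S(1 + √C)(τ(d)² √d/δ + N (c, d)/(dq))`,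
  and `MatomakiMerikoski2023_lemma38_rpow` — the printed form `≪_{ε,S,C} δ⁻¹ d^{1/2+ε} + N(c,d)/(dq)`
  (divisor bound `τ(d)² ≪_ε d^ε`, `Literature.NumberTheory.Sieve.exists_card_divisors_le_mul_rpow`).

## References

* K. Matomäki, J. Merikoski, IMRN 2023:23, 20337–20384 (arXiv:2112.11412), §3.5, Lemmas 3.5, 3.7,
  3.8 and the proof of Lemma 3.8 ((3.9)). [cite: MatomakiMerikoski2023, Lemma 3.8]
* H. Iwaniec, *Spectral Methods of Automorphic Forms*, 2nd ed., GSM 53 (2002), §2.5 (2.25)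
  (Weil's bound; the tree's `weil_kloosterman_bound`). [cite: Iwaniec2002, §2.5 (2.25)]
-/

noncomputable section

open Real MeasureTheory Filter Complex Finset
open scoped FourierTransform Topology ContDiff

namespace Literature.NumberTheory.LFunctions.MatomakiMerikoski

open Literature.NumberTheory.Sieve (ramanujanSum ramanujanSum_def sum_divisors_ramanujanSum_eq_ite
  ramanujanSum_mul_of_coprime)

/-! ### The `h = 0` term: Ramanujan sums -/

/-- `S(0, c; d) = c_d(c)`: a Kloosterman sum with one entry zero is a Ramanujan sum
(`S(0, c; d) = S(c, 0; d) = ∑_{x ∈ (ℤ/d)ˣ} e_d(cx)`). [folklore] -/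
theorem kloostermanSum_zero_left_eq_ramanujanSum (d : ℕ) [NeZero d] (c : ZMod d) :
    kloostermanSum d 0 c = ramanujanSum d (c.val : ℤ) := by
  classical
  rw [kloostermanSum_comm]
  unfold kloostermanSum
  rw [sum_zmod_eq_sum_range, ramanujanSum_def, sum_filter]
  refine sum_congr rfl fun n _ => ?_
  by_cases h : n.Coprime d
  · rw [if_pos ((ZMod.isUnit_iff_coprime n d).mpr h), if_pos h, zero_mul, add_zero]
    have : c * (n : ZMod d) = (((c.val : ℤ) * n : ℤ) : ZMod d) := by
      push_cast; rw [ZMod.natCast_zmod_val]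
    rw [this, ZMod.stdAddChar_coe, Real.fourierChar_apply]
    congr 1
    push_cast
    ring
  · rw [if_neg (fun hu => h ((ZMod.isUnit_iff_coprime n d).mp hu)), if_neg h]

/-- The prime-power values of Ramanujan's sum: for `a ≥ 1`,
`c_{p^a}(h) = p^a [p^a ∣ h] − p^{a−1} [p^{a−1} ∣ h]` (from `∑_{d ∣ q} c_d(h) = q[q ∣ h]` at
`q = p^a` and `q = p^{a−1}`). [cite: MontgomeryVaughan2007, Thm 4.1] -/
theorem ramanujanSum_prime_pow {p : ℕ} (hp : p.Prime) {a : ℕ} (ha : 1 ≤ a) (h : ℤ) :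
    ramanujanSum (p ^ a) h =
      (if ((p ^ a : ℕ) : ℤ) ∣ h then ((p ^ a : ℕ) : ℂ) else 0) -
        (if ((p ^ (a - 1) : ℕ) : ℤ) ∣ h then ((p ^ (a - 1) : ℕ) : ℂ) else 0) := by
  have hsum : ∀ b : ℕ, ∑ i ∈ Finset.range (b + 1), ramanujanSum (p ^ i) h =
      if ((p ^ b : ℕ) : ℤ) ∣ h then ((p ^ b : ℕ) : ℂ) else 0 := by
    intro b
    have h1 := sum_divisors_ramanujanSum_eq_ite (pow_ne_zero b hp.ne_zero) h
    rw [Nat.divisors_prime_pow hp b, Finset.sum_map] at h1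
    exact h1
  have h1 := hsum a
  have h2 := hsum (a - 1)
  rw [show a - 1 + 1 = a from Nat.sub_add_cancel ha] at h2
  rw [Finset.sum_range_succ, h2] at h1
  rw [← h1]
  ring

/-- **`|c_q(h)| ≤ (h, q)`** for all `q` and `h` (multiplicativity in `q` and the prime-power values).
[folklore] -/
theorem norm_ramanujanSum_le_gcd (q : ℕ) (h : ℤ) : ‖ramanujanSum q h‖ ≤ Int.gcd h q := by
  induction q using Nat.recOnPosPrimePosCoprime with
  | zero => simp
  | one => simp
  | prime_pow p a hp ha =>
    rw [ramanujanSum_prime_pow hp ha h]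
    have hI : Int.gcd h ((p ^ a : ℕ) : ℤ) = Nat.gcd h.natAbs (p ^ a) := by
      rw [Int.gcd_eq_natAbs, Int.natAbs_natCast]
    have hgcd : ∀ b : ℕ, (p ^ b : ℕ) ∣ Int.gcd h ((p ^ a : ℕ) : ℤ) →
        ((p ^ b : ℕ) : ℝ) ≤ Int.gcd h ((p ^ a : ℕ) : ℤ) := by
      intro b hdvd
      have hpos : 0 < Int.gcd h ((p ^ a : ℕ) : ℤ) := by
        rw [hI]; exact Nat.gcd_pos_of_pos_right _ (pow_pos hp.pos a)
      exact_mod_cast Nat.le_of_dvd hpos hdvd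
    have hga : ∀ b : ℕ, b ≤ a → ((p ^ b : ℕ) : ℤ) ∣ h → (p ^ b : ℕ) ∣ Int.gcd h ((p ^ a : ℕ) : ℤ) := by
      intro b hb hdvd
      rw [hI]
      exact Nat.dvd_gcd (Int.natCast_dvd.mp hdvd) (pow_dvd_pow p hb)
    by_cases hA : ((p ^ a : ℕ) : ℤ) ∣ h
    · have hA' : ((p ^ (a - 1) : ℕ) : ℤ) ∣ h :=
        dvd_trans (by exact_mod_cast pow_dvd_pow p (Nat.sub_le a 1)) hA
      rw [if_pos hA, if_pos hA']
      have hle := hgcd a (hga a le_rfl hA)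
      have hp1 : ((p ^ (a - 1) : ℕ) : ℝ) ≤ (p ^ a : ℕ) := by
        exact_mod_cast Nat.pow_le_pow_right hp.pos (Nat.sub_le a 1)
      have h0 : (0 : ℝ) ≤ (p ^ (a - 1) : ℕ) := Nat.cast_nonneg _
      rw [show ((p ^ a : ℕ) : ℂ) - ((p ^ (a - 1) : ℕ) : ℂ) = (((p ^ a : ℕ) : ℝ) - ((p ^ (a - 1) : ℕ) : ℝ) : ℝ)
        by push_cast; ring, Complex.norm_real, Real.norm_eq_abs, abs_of_nonneg (by linarith)]
      linarith
    · rw [if_neg hA, zero_sub, norm_neg]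
      by_cases hB : ((p ^ (a - 1) : ℕ) : ℤ) ∣ h
      · rw [if_pos hB]
        have hle := hgcd (a - 1) (hga (a - 1) (Nat.sub_le a 1) hB)
        rw [show ((p ^ (a - 1) : ℕ) : ℂ) = (((p ^ (a - 1) : ℕ) : ℝ) : ℂ) by push_cast; rfl,
          Complex.norm_real, Real.norm_eq_abs, abs_of_nonneg (Nat.cast_nonneg _)]
        exact hle
      · rw [if_neg hB, norm_zero]
        exact Nat.cast_nonneg _
  | coprime m n hm hn hmn ihm ihn =>
    rw [ramanujanSum_mul_of_coprime hmn, norm_mul]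
    have hg : (Int.gcd h (m * n : ℕ) : ℝ) = Int.gcd h m * Int.gcd h n := by
      rw [Int.gcd_eq_natAbs, Int.gcd_eq_natAbs, Int.gcd_eq_natAbs, Int.natAbs_natCast,
        Int.natAbs_natCast, Int.natAbs_natCast, Nat.Coprime.gcd_mul _ hmn, Nat.cast_mul]
    rw [hg]
    exact mul_le_mul ihm ihn (norm_nonneg _) (Nat.cast_nonneg _)

/-- **The `h = 0` term**: `|S(0, c; d)| ≤ (c, d)`. [cite: MatomakiMerikoski2023, proof of Lemma 3.8] -/
theorem norm_kloostermanSum_zero_left_le (d : ℕ) [NeZero d] (c : ZMod d) :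
    ‖kloostermanSum d 0 c‖ ≤ Nat.gcd c.val d := by
  rw [kloostermanSum_zero_left_eq_ramanujanSum]
  refine (norm_ramanujanSum_le_gcd d (c.val : ℤ)).trans (le_of_eq ?_)
  rw [Int.gcd_natCast_natCast]

/-! ### The complete sum is a Kloosterman sum -/

/-- **(3.9) of the source, in norm**: for `(q, d) = 1`, `q̄ = q⁻¹ (mod d)`, `h ∈ ℤ`, `α ∈ ℤ`,
`c ∈ ℤ/d`, the complete sum over the residues `n = α + qj (mod dq)`, `0 ≤ j < d`
(i.e. `n ≡ α (mod q)`) of `1_{(n,d)=1} e_d(c n̄) e(hn/(dq))` has modulus `|S(h q̄, c; d)|`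
("Since `(d, q) = 1`, by the Chinese remainder theorem we can write `n = αd d̄ + βq q̄` … to get
`… = e_q(hα d̄) S(h q̄, k ē; d)`"; here via the substitution `β = α + qj` in `ℤ/d`).
[cite: MatomakiMerikoski2023, proof of Lemma 3.8, (3.9)] -/
theorem norm_completeSum_eq {d q : ℕ} [NeZero d] (hq : 0 < q) (hqd : q.Coprime d) (α h : ℤ)
    (c : ZMod d) :
    ‖∑ j ∈ Finset.range d,
        (if IsUnit ((α + q * j : ℤ) : ZMod d) then
            (ZMod.stdAddChar (c * ((α + q * j : ℤ) : ZMod d)⁻¹) : ℂ) else 0) *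
          (𝐞 (((α + q * j : ℤ) : ℝ) * h / (q * d : ℕ)) : ℂ)‖ =
      ‖kloostermanSum d ((h : ZMod d) * (q : ZMod d)⁻¹) c‖ := by
  classical
  have hd0 : 0 < d := Nat.pos_of_ne_zero (NeZero.ne d)
  have hqd' : IsUnit (q : ZMod d) := (ZMod.isUnit_iff_coprime q d).mpr hqd
  set qi : ZMod d := (q : ZMod d)⁻¹ with hqi
  have hqqi : (q : ZMod d) * qi = 1 := ZMod.mul_inv_of_unit _ hqd'
  -- Step 1: factor `e(h(α + qj)/(qd)) = e(hα/(qd)) · e_d(hj)`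
  have hphase : ∀ j : ℕ, (𝐞 (((α + q * j : ℤ) : ℝ) * h / (q * d : ℕ)) : ℂ) =
      (𝐞 ((α : ℝ) * h / (q * d : ℕ)) : ℂ) * (ZMod.stdAddChar ((h : ZMod d) * (j : ZMod d)) : ℂ) := by
    intro j
    have e1 : (h : ZMod d) * (j : ZMod d) = (((h * j : ℤ)) : ZMod d) := by push_cast; ring
    rw [e1, ZMod.stdAddChar_coe, Real.fourierChar_apply, Real.fourierChar_apply, ← Complex.exp_add]
    congr 1
    have hq0 : (q : ℂ) ≠ 0 := by exact_mod_cast hq.ne'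
    have hd0' : (d : ℂ) ≠ 0 := by exact_mod_cast hd0.ne'
    push_cast
    field_simp
  -- Step 2: the summand as a function on `ℤ/d` of `j`
  set Φ : ZMod d → ℂ := fun x =>
    (if IsUnit ((α : ZMod d) + (q : ZMod d) * x) then
        (ZMod.stdAddChar (c * ((α : ZMod d) + (q : ZMod d) * x)⁻¹) : ℂ) else 0) *
      (ZMod.stdAddChar ((h : ZMod d) * x) : ℂ) with hΦ
  have hsummand : ∀ j : ℕ,
      (if IsUnit ((α + q * j : ℤ) : ZMod d) then
          (ZMod.stdAddChar (c * ((α + q * j : ℤ) : ZMod d)⁻¹) : ℂ) else 0) *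
        (𝐞 (((α + q * j : ℤ) : ℝ) * h / (q * d : ℕ)) : ℂ) =
      (𝐞 ((α : ℝ) * h / (q * d : ℕ)) : ℂ) * Φ (j : ZMod d) := by
    intro j
    rw [hphase j]
    have hcast : ((α + q * j : ℤ) : ZMod d) = (α : ZMod d) + (q : ZMod d) * (j : ZMod d) := by
      push_cast; ring
    simp only [hΦ, hcast]
    ring
  rw [Finset.sum_congr rfl fun j _ => hsummand j, ← Finset.mul_sum, norm_mul,
    Circle.norm_coe, one_mul, ← sum_zmod_eq_sum_range Φ]
  -- Step 3: substitute `β = α + q x` (an affine bijection of `ℤ/d`)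
  have hbij : ∑ x : ZMod d, Φ x =
      ∑ β : ZMod d, (if IsUnit β then (ZMod.stdAddChar (c * β⁻¹) : ℂ) else 0) *
        (ZMod.stdAddChar ((h : ZMod d) * (qi * (β - (α : ZMod d)))) : ℂ) := by
    refine Finset.sum_nbij' (fun x => (α : ZMod d) + (q : ZMod d) * x) (fun β => qi * (β - (α : ZMod d)))
      (fun _ _ => Finset.mem_univ _) (fun _ _ => Finset.mem_univ _) (fun x _ => ?_) (fun β _ => ?_)
      (fun x _ => ?_)
    · -- left inverse
      calc qi * ((α : ZMod d) + (q : ZMod d) * x - (α : ZMod d)) = ((q : ZMod d) * qi) * x := by ring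
        _ = x := by rw [hqqi, one_mul]
    · calc (α : ZMod d) + (q : ZMod d) * (qi * (β - (α : ZMod d)))
          = (α : ZMod d) + ((q : ZMod d) * qi) * (β - (α : ZMod d)) := by ring
        _ = β := by rw [hqqi]; ring
    · simp only [hΦ]
      congr 2
      calc (h : ZMod d) * x = (h : ZMod d) * (((q : ZMod d) * qi) * x) := by rw [hqqi, one_mul]
        _ = (h : ZMod d) * (qi * ((α : ZMod d) + (q : ZMod d) * x - (α : ZMod d))) := by ring
  rw [hbij]
  -- Step 4: pull out the phase `e_d(-h qi α)` and recognise `S(h qi, c; d)`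
  have hsplit : ∀ β : ZMod d, (ZMod.stdAddChar ((h : ZMod d) * (qi * (β - (α : ZMod d)))) : ℂ) =
      (ZMod.stdAddChar (-((h : ZMod d) * qi * (α : ZMod d))) : ℂ) *
        (ZMod.stdAddChar ((h : ZMod d) * qi * β) : ℂ) := by
    intro β
    rw [← AddChar.map_add_eq_mul]
    congr 1; ring
  simp_rw [hsplit]
  have hre : ∑ β : ZMod d, (if IsUnit β then (ZMod.stdAddChar (c * β⁻¹) : ℂ) else 0) *
        ((ZMod.stdAddChar (-((h : ZMod d) * qi * (α : ZMod d))) : ℂ) *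
          (ZMod.stdAddChar ((h : ZMod d) * qi * β) : ℂ)) =
      (ZMod.stdAddChar (-((h : ZMod d) * qi * (α : ZMod d))) : ℂ) *
        kloostermanSum d ((h : ZMod d) * qi) c := by
    unfold kloostermanSum
    rw [Finset.mul_sum]
    refine Finset.sum_congr rfl fun β _ => ?_
    split_ifs with hβ
    · rw [← AddChar.map_add_eq_mul, ← AddChar.map_add_eq_mul, ← AddChar.map_add_eq_mul]
      congr 1; ring
    · simp
  rw [hre, norm_mul, ZMod.stdAddChar_apply, Circle.norm_coe, one_mul]

/-! ### Weil's bound in the form used -/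

/-- **Weil's bound for `S(h q̄, c; d)`**: `|S(h q̄, c; d)| ≤ τ(d) d^{1/2} (h, d)^{1/2}` for `q̄` a
unit of `ℤ/d` (the tree's PROVED `weil_kloosterman_bound_holds`, `(h q̄, c, d) ∣ (h, d)` since
`(q̄, d) = 1`). [cite: MatomakiMerikoski2023, Lemma 3.5] -/
theorem norm_kloostermanSum_le_gcd_sqrt {d : ℕ} [NeZero d] {u : ZMod d} (hu : IsUnit u) (h : ℤ)
    (c : ZMod d) :
    ‖kloostermanSum d ((h : ZMod d) * u) c‖ ≤
      (#d.divisors : ℝ) * Real.sqrt d * Real.sqrt (Int.gcd h d) := by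
  have hd0 : 0 < d := Nat.pos_of_ne_zero (NeZero.ne d)
  -- integer representatives
  set m : ℤ := h * (u.val : ℤ) with hm
  set n : ℤ := (c.val : ℤ) with hn
  have hmc : ((m : ℤ) : ZMod d) = (h : ZMod d) * u := by
    rw [hm]; push_cast; rw [ZMod.natCast_zmod_val]
  have hnc : ((n : ℤ) : ZMod d) = c := by rw [hn]; push_cast; exact ZMod.natCast_zmod_val c
  have hW := weil_kloosterman_bound_holds d m n
  rw [hmc, hnc] at hW
  refine hW.trans ?_
  -- `gcd(gcd |m| |n|, d) ≤ gcd(|h|, d)` because `gcd(u.val, d) = 1`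
  have hcop : Nat.Coprime u.val d := by
    have := (ZMod.isUnit_iff_coprime u.val d).mp (by rw [ZMod.natCast_zmod_val]; exact hu)
    exact this
  have hgcd : (Nat.gcd (Nat.gcd m.natAbs n.natAbs) d : ℝ) ≤ (Int.gcd h d : ℝ) := by
    have h1 : Nat.gcd (Nat.gcd m.natAbs n.natAbs) d ∣ Nat.gcd m.natAbs d :=
      Nat.gcd_dvd_gcd_of_dvd_left d (Nat.gcd_dvd_left _ _)
    have h2 : Nat.gcd m.natAbs d = Nat.gcd h.natAbs d := by
      rw [hm, Int.natAbs_mul, Int.natAbs_natCast]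
      exact Nat.Coprime.gcd_mul_right_cancel _ hcop
    have hI : Int.gcd h d = Nat.gcd h.natAbs d := by rw [Int.gcd_eq_natAbs, Int.natAbs_natCast]
    rw [hI]
    have hpos : 0 < Nat.gcd h.natAbs d := Nat.gcd_pos_of_pos_right _ hd0
    exact_mod_cast Nat.le_of_dvd hpos (h2 ▸ h1)
  calc Real.sqrt (Nat.gcd (Nat.gcd m.natAbs n.natAbs) d) * Real.sqrt d * #d.divisors
      ≤ Real.sqrt (Int.gcd h d) * Real.sqrt d * #d.divisors := by gcongr
    _ = (#d.divisors : ℝ) * Real.sqrt d * Real.sqrt (Int.gcd h d) := by ring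

/-! ### The analytic sums -/

/-- `∑_{1 ≤ m ≤ M} min(A, B/m²) ≤ 3√(AB)` for `A, B ≥ 0` (split at `m ≈ √(B/A)`;
`∑_{m > K} m⁻² ≤ 2/(K+1)`). [folklore] -/
theorem sum_min_const_div_sq_le {A B : ℝ} (hA : 0 ≤ A) (hB : 0 ≤ B) (M : ℕ) :
    ∑ m ∈ Icc 1 M, min A (B / (m : ℝ) ^ 2) ≤ 3 * Real.sqrt (A * B) := by
  have hsq0 : 0 ≤ Real.sqrt (A * B) := Real.sqrt_nonneg _
  -- degenerate cases
  rcases hA.eq_or_lt with hA0 | hA0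
  · calc ∑ m ∈ Icc 1 M, min A (B / (m : ℝ) ^ 2) ≤ ∑ m ∈ Icc 1 M, (0 : ℝ) :=
          sum_le_sum fun m _ => (min_le_left _ _).trans (le_of_eq hA0.symm)
      _ ≤ 3 * Real.sqrt (A * B) := by rw [sum_const_zero]; positivity
  rcases hB.eq_or_lt with hB0 | hB0
  · calc ∑ m ∈ Icc 1 M, min A (B / (m : ℝ) ^ 2) ≤ ∑ m ∈ Icc 1 M, (0 : ℝ) :=
          sum_le_sum fun m _ => (min_le_right _ _).trans (le_of_eq (by rw [← hB0, zero_div]))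
      _ ≤ 3 * Real.sqrt (A * B) := by rw [sum_const_zero]; positivity
  -- `√(AB) = √A √B`, `A = √A²`, `B = √B²`
  have hsA : 0 < Real.sqrt A := Real.sqrt_pos.mpr hA0
  have hsB : 0 < Real.sqrt B := Real.sqrt_pos.mpr hB0
  have hAB : Real.sqrt (A * B) = Real.sqrt A * Real.sqrt B := Real.sqrt_mul hA B
  have hA2 : A = Real.sqrt A ^ 2 := (Real.sq_sqrt hA).symm
  have hB2 : B = Real.sqrt B ^ 2 := (Real.sq_sqrt hB).symm
  set K : ℕ := ⌊Real.sqrt B / Real.sqrt A⌋₊ with hK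
  have hK1 : (K : ℝ) ≤ Real.sqrt B / Real.sqrt A := Nat.floor_le (by positivity)
  have hK2 : Real.sqrt B / Real.sqrt A < (K : ℝ) + 1 := Nat.lt_floor_add_one _
  have hmin0 : ∀ m : ℕ, 0 ≤ min A (B / (m : ℝ) ^ 2) := fun m => le_min hA (by positivity)
  -- split at `K`
  rw [← sum_filter_add_sum_filter_not (Icc 1 M) (fun m : ℕ => m ≤ K)]
  have h1 : ∑ m ∈ (Icc 1 M).filter (fun m : ℕ => m ≤ K), min A (B / (m : ℝ) ^ 2) ≤
      Real.sqrt (A * B) := by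
    calc ∑ m ∈ (Icc 1 M).filter (fun m : ℕ => m ≤ K), min A (B / (m : ℝ) ^ 2)
        ≤ ∑ m ∈ (Icc 1 M).filter (fun m : ℕ => m ≤ K), A := sum_le_sum fun m _ => min_le_left _ _
      _ = (#((Icc 1 M).filter (fun m : ℕ => m ≤ K)) : ℝ) * A := by rw [sum_const, nsmul_eq_mul]
      _ ≤ (K : ℝ) * A := by
          refine mul_le_mul_of_nonneg_right ?_ hA
          have hsub : (Icc 1 M).filter (fun m : ℕ => m ≤ K) ⊆ Icc 1 K := by
            intro m hm
            rw [mem_filter, mem_Icc] at hm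
            exact mem_Icc.mpr ⟨hm.1.1, hm.2⟩
          have := card_le_card hsub
          rw [Nat.card_Icc] at this
          exact_mod_cast (show #((Icc 1 M).filter (fun m : ℕ => m ≤ K)) ≤ K by omega)
      _ ≤ Real.sqrt B / Real.sqrt A * A := mul_le_mul_of_nonneg_right hK1 hA
      _ = Real.sqrt (A * B) := by
          rw [hAB]; nth_rewrite 2 [hA2]; field_simp
  have h2 : ∑ m ∈ (Icc 1 M).filter (fun m : ℕ => ¬ m ≤ K), min A (B / (m : ℝ) ^ 2) ≤
      2 * Real.sqrt (A * B) := by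
    calc ∑ m ∈ (Icc 1 M).filter (fun m : ℕ => ¬ m ≤ K), min A (B / (m : ℝ) ^ 2)
        ≤ ∑ m ∈ (Icc 1 M).filter (fun m : ℕ => ¬ m ≤ K), B * ((m : ℝ) ^ 2)⁻¹ :=
          sum_le_sum fun m _ => (min_le_right _ _).trans (le_of_eq (div_eq_mul_inv _ _))
      _ ≤ ∑ m ∈ Ioo K (M + 1), B * ((m : ℝ) ^ 2)⁻¹ := by
          refine sum_le_sum_of_subset_of_nonneg (fun m hm => ?_) fun _ _ _ => by positivity
          rw [mem_filter, mem_Icc, not_le] at hm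
          rw [mem_Ioo]; omega
      _ = B * ∑ m ∈ Ioo K (M + 1), ((m : ℝ) ^ 2)⁻¹ := by rw [mul_sum]
      _ ≤ B * (2 / ((K : ℝ) + 1)) := mul_le_mul_of_nonneg_left (sum_Ioo_inv_sq_le K (M + 1)) hB
      _ ≤ 2 * Real.sqrt (A * B) := by
          -- `B/(K+1) ≤ B √A/√B = √A √B`
          have hK3 : 0 < (K : ℝ) + 1 := by positivity
          rw [hAB, mul_div_assoc', div_le_iff₀ hK3]
          nth_rewrite 1 [hB2]
          have : Real.sqrt B ≤ Real.sqrt A * ((K : ℝ) + 1) := by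
            rw [div_lt_iff₀ hsA] at hK2; linarith
          nlinarith [hsB.le, hsA.le]
  linarith

/-- Multiples of `e` in `[1, H]` are the `e m`, `1 ≤ m ≤ H/e`. [folklore] -/
theorem Icc_filter_dvd_eq_image {e : ℕ} (he : 0 < e) (H : ℕ) :
    (Icc 1 H).filter (e ∣ ·) = (Icc 1 (H / e)).image (fun m => e * m) := by
  ext ℓ
  simp only [mem_filter, mem_Icc, mem_image]
  constructor
  · rintro ⟨⟨h1, h2⟩, m, rfl⟩
    refine ⟨m, ⟨?_, ?_⟩, rfl⟩
    · rcases Nat.eq_zero_or_pos m with hm | hm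
      · subst hm; omega
      · exact hm
    · exact (Nat.le_div_iff_mul_le he).mpr (by rw [mul_comm]; exact h2)
  · rintro ⟨m, ⟨hm1, hm2⟩, rfl⟩
    refine ⟨⟨Nat.mul_pos he (by omega), ?_⟩, dvd_mul_right e m⟩
    have := (Nat.le_div_iff_mul_le he).mp hm2
    rw [mul_comm]; exact this

/-- **`∑_{1 ≤ h ≤ H} (h, d) min(A, B/h²) ≤ 3 τ(d) √(AB)`** for `A, B ≥ 0`, `d ≥ 1`
(`(h, d) ≤ ∑_{e ∣ d, e ∣ h} e`, `h = em`, and `sum_min_const_div_sq_le` with `B/e²`; the source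
invokes Lemma 3.7 at this point). [cite: MatomakiMerikoski2023, proof of Lemma 3.8] -/
theorem sum_gcd_mul_min_le {A B : ℝ} (hA : 0 ≤ A) (hB : 0 ≤ B) {d : ℕ} (hd : d ≠ 0) (H : ℕ) :
    ∑ h ∈ Icc 1 H, (Nat.gcd h d : ℝ) * min A (B / (h : ℝ) ^ 2) ≤
      3 * #d.divisors * Real.sqrt (A * B) := by
  have hmin0 : ∀ h : ℕ, 0 ≤ min A (B / (h : ℝ) ^ 2) := fun h => le_min hA (by positivity)
  calc ∑ h ∈ Icc 1 H, (Nat.gcd h d : ℝ) * min A (B / (h : ℝ) ^ 2)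
      ≤ ∑ h ∈ Icc 1 H, (∑ e ∈ d.divisors, if e ∣ h then (e : ℝ) else 0) *
          min A (B / (h : ℝ) ^ 2) := by
        refine sum_le_sum fun h _ => mul_le_mul_of_nonneg_right ?_ (hmin0 h)
        rw [← sum_filter]
        exact gcd_le_sum_divisors_filter_dvd hd h
    _ = ∑ e ∈ d.divisors, ∑ h ∈ Icc 1 H, (if e ∣ h then (e : ℝ) else 0) *
          min A (B / (h : ℝ) ^ 2) := by rw [sum_comm]; simp only [sum_mul]
    _ = ∑ e ∈ d.divisors, (e : ℝ) * ∑ h ∈ (Icc 1 H).filter (e ∣ ·),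
          min A (B / (h : ℝ) ^ 2) := by
        refine sum_congr rfl fun e _ => ?_
        rw [sum_filter, mul_sum]
        refine sum_congr rfl fun h _ => ?_
        split_ifs <;> simp
    _ ≤ ∑ e ∈ d.divisors, (e : ℝ) * (3 * Real.sqrt (A * (B / (e : ℝ) ^ 2))) := by
        refine sum_le_sum fun e he => mul_le_mul_of_nonneg_left ?_ (Nat.cast_nonneg e)
        have he0 : 0 < e := Nat.pos_of_mem_divisors he
        have he0' : (0 : ℝ) < e := by exact_mod_cast he0
        rw [Icc_filter_dvd_eq_image he0, sum_image (fun m₁ _ m₂ _ h => Nat.eq_of_mul_eq_mul_left he0 h)]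
        have hB' : 0 ≤ B / (e : ℝ) ^ 2 := by positivity
        refine le_trans (le_of_eq (sum_congr rfl fun m _ => ?_)) (sum_min_const_div_sq_le hA hB' (H / e))
        push_cast
        rw [mul_pow, div_div]
    _ = ∑ e ∈ d.divisors, 3 * Real.sqrt (A * B) := by
        refine sum_congr rfl fun e he => ?_
        have he0' : (0 : ℝ) < e := by exact_mod_cast Nat.pos_of_mem_divisors he
        rw [show A * (B / (e : ℝ) ^ 2) = A * B / (e : ℝ) ^ 2 by ring, Real.sqrt_div' _ (by positivity),
          Real.sqrt_sq he0'.le]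
        field_simp
    _ = 3 * #d.divisors * Real.sqrt (A * B) := by rw [sum_const, nsmul_eq_mul]; ring

/-! ### `L¹` norms of a bounded function with support in `[-S, S]` -/

/-- `∫ |G| ≤ 2S · M` when `|G| ≤ M`, `G` is continuous and vanishes outside `[-S, S]`. [folklore] -/
theorem integral_norm_le_of_support {G : ℝ → ℂ} (hG : Continuous G) {S M : ℝ} (hS : 0 ≤ S)
    (hM : ∀ x, ‖G x‖ ≤ M) (hsupp : Function.support G ⊆ Set.Icc (-S) S) :
    ∫ t, ‖G t‖ ≤ 2 * S * M := by
  have hM0 : 0 ≤ M := (norm_nonneg _).trans (hM 0)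
  have hzero : ∀ x, x ∉ Set.Icc (-S) S → ‖G x‖ = 0 := by
    intro x hx
    rw [norm_eq_zero]
    by_contra h
    exact hx (hsupp (Function.mem_support.mpr h))
  rw [← setIntegral_eq_integral_of_forall_compl_eq_zero hzero]
  calc ∫ t in Set.Icc (-S) S, ‖G t‖ ≤ ∫ t in Set.Icc (-S) S, M :=
        setIntegral_mono_on (hG.norm.integrableOn_Icc)
          (continuous_const : Continuous fun _ : ℝ => M).integrableOn_Icc measurableSet_Icc
          fun x _ => hM x
    _ = 2 * S * M := by
        rw [setIntegral_const, Real.volume_real_Icc_of_le (by linarith), smul_eq_mul]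
        ring

/-! ### Lemma 3.8 -/

/-- **Matomäki–Merikoski 2023, Lemma 3.8, with explicit constants.** Let `F : ℝ → ℂ` be smooth
with `tsupport F ⊆ [-S, S]` (`S > 0`), `|F| ≤ 1` and `|F''| ≤ C/δ²` (`C ≥ 0`, `δ > 0`); let
`N > 0`, `d, q ≥ 1` with `(q, d) = 1`, `α ∈ ℤ` and `c ∈ ℤ/d`. Then the smoothed incomplete
Kloosterman sum along `n ≡ α (mod q)`,
`Σ = ∑_{m ∈ ℤ} F((α + qm)/N) 1_{(α+qm, d)=1} e_d(c (α+qm)‾)`, satisfies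
`|Σ| ≤ 2S(1 + √C) (τ(d)² √d / δ + N (c, d)/(dq))`.
This is the source's "`∑_{n ≡ α (q), (n,d)=1} F(n/N) e_d(k (en)‾) ≪_ε δ⁻¹ d^{1/2+ε} + N(d,k)/(dq)`"
with `c = k ē` (`(d, c) = (d, k)`), before the divisor bound `τ(d)² ≪_ε d^ε`; proof as printed:
Poisson summation (Lemma 3.4), the complete sums are `e_q(hα d̄) S(h q̄, c; d)` ((3.9)), the `h = 0`
term is a Ramanujan sum `≪ (d, c)`, `|F̂(ξ)| ≤ min(‖F‖₁, ‖F''‖₁/(2πξ)²)` by partial integration,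
Weil's bound, and `∑_h (h, d) min(A, B/h²) ≪ τ(d)√(AB)`.
[cite: MatomakiMerikoski2023, Lemma 3.8] -/
theorem MatomakiMerikoski2023_lemma38 {F : ℝ → ℂ} (hF : ContDiff ℝ ∞ F) {S : ℝ} (hS : 0 < S)
    (hsupp : tsupport F ⊆ Set.Icc (-S) S) (hF1 : ∀ x, ‖F x‖ ≤ 1) {C δ : ℝ} (hC : 0 ≤ C)
    (hδ : 0 < δ) (hF2 : ∀ x, ‖iteratedDeriv 2 F x‖ ≤ C / δ ^ 2) {N : ℝ} (hN : 0 < N)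
    {d q : ℕ} (hd : 0 < d) (hq : 0 < q) (hqd : q.Coprime d) (α : ℤ) (c : ZMod d) :
    ‖∑' m : ℤ, F ((α + q * m) / N) *
        (haveI : NeZero d := ⟨hd.ne'⟩
         if IsUnit ((α + q * m : ℤ) : ZMod d) then
            (ZMod.stdAddChar (c * ((α + q * m : ℤ) : ZMod d)⁻¹) : ℂ) else 0)‖ ≤
      2 * S * (1 + Real.sqrt C) *
        ((#d.divisors : ℝ) ^ 2 * Real.sqrt d / δ + N * Nat.gcd c.val d / (d * q)) := by
  haveI : NeZero d := ⟨hd.ne'⟩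
  classical
  -- the weight `G(n) = 1_{(n,d)=1} e_d(c n̄)`, `d`-periodic and bounded by `1`
  set G : ℤ → ℂ := fun n =>
    if IsUnit ((n : ℤ) : ZMod d) then (ZMod.stdAddChar (c * ((n : ℤ) : ZMod d)⁻¹) : ℂ) else 0
    with hG_def
  have hGper : ∀ m n : ℤ, G (m + d * n) = G m := by
    intro m n
    have : ((m + d * n : ℤ) : ZMod d) = (m : ZMod d) := by push_cast; simp
    simp only [hG_def, this]
  show ‖∑' m : ℤ, F ((α + q * m) / N) * G (α + q * m)‖ ≤ _
  -- compact support and the two `L¹` bounds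
  have hsuppF : Function.support F ⊆ Set.Icc (-S) S := (subset_tsupport F).trans hsupp
  have hFc : HasCompactSupport F := HasCompactSupport.of_support_subset_isCompact isCompact_Icc hsuppF
  have hL1 : ∫ t, ‖F t‖ ≤ 2 * S * 1 := integral_norm_le_of_support hF.continuous hS.le hF1 hsuppF
  have hsuppF2 : Function.support (iteratedDeriv 2 F) ⊆ Set.Icc (-S) S := by
    rw [show iteratedDeriv 2 F = deriv (deriv F) by
      rw [iteratedDeriv_succ, iteratedDeriv_one]]
    exact support_deriv_subset.trans (tsupport_deriv_subset.trans hsupp)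
  have hcont : ∀ n : ℕ, Continuous (iteratedDeriv n F) := fun n =>
    hF.continuous_iteratedDeriv n (by exact_mod_cast le_top)
  have hL2 : ∫ t, ‖iteratedDeriv 2 F t‖ ≤ 2 * S * (C / δ ^ 2) :=
    integral_norm_le_of_support (hcont 2) hS.le hF2 hsuppF2
  -- Poisson summation (Lemma 3.4, scaled)
  have hdq : 0 < q * d := Nat.mul_pos hq hd
  have hdqr : (0 : ℝ) < (q * d : ℕ) := by exact_mod_cast hdq
  rw [MatomakiMerikoski2023_lemma34_scaled hF hFc hN hq hd α hGper, norm_mul]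
  -- the complete sums and their bounds
  set qi : ZMod d := (q : ZMod d)⁻¹ with hqi
  have hqi_unit : IsUnit qi := by
    have hqu : IsUnit (q : ZMod d) := (ZMod.isUnit_iff_coprime q d).mpr hqd
    obtain ⟨u, hu⟩ := hqu
    rw [hqi, ← hu, ZMod.inv_coe_unit]
    exact Units.isUnit _
  set T : ℤ → ℂ := fun h => ∑ j ∈ Finset.range d, G (α + q * j) *
      (𝐞 (((α + q * j : ℤ) : ℝ) * h / (q * d : ℕ)) : ℂ) with hT_def
  have hTnorm : ∀ h : ℤ, ‖T h‖ = ‖kloostermanSum d ((h : ZMod d) * qi) c‖ := fun h =>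
    norm_completeSum_eq hq hqd α h c
  -- constants
  set A : ℝ := 2 * S with hA_def
  have hA0 : 0 < A := by positivity
  set B₃ : ℝ := A * (C / δ ^ 2) * ((q * d : ℕ) : ℝ) ^ 2 / ((2 * π) ^ 2 * N ^ 2) with hB₃_def
  have hB₃0 : 0 ≤ B₃ := by positivity
  set τd : ℝ := (#d.divisors : ℝ) with hτd
  have hτd1 : 1 ≤ τd := by
    rw [hτd]; exact_mod_cast Finset.card_pos.mpr ⟨1, Nat.one_mem_divisors.mpr hd.ne'⟩
  -- the majorant `g`
  set g : ℤ → ℝ := fun h => if h = 0 then A * (Nat.gcd c.val d : ℝ)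
      else τd * Real.sqrt d * ((Int.gcd h d : ℕ) : ℝ) * min A (B₃ / (h : ℝ) ^ 2) with hg_def
  have hg0 : ∀ h, 0 ≤ g h := by
    intro h; simp only [hg_def]
    split_ifs
    · positivity
    · exact mul_nonneg (by positivity) (le_min hA0.le (by positivity))
  -- pointwise domination `‖𝓕F(Nh/(qd)) T(h)‖ ≤ g h`
  have hFour0 : ∀ ξ : ℝ, ‖𝓕 F ξ‖ ≤ A := fun ξ =>
    (Literature.NumberTheory.Sieve.FriedlanderIwaniecPrimes.norm_fourier_le_integral_norm F ξ).trans
      (by linarith)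
  have hFour2 : ∀ h : ℤ, h ≠ 0 → ‖𝓕 F (N * h / (q * d : ℕ))‖ ≤ B₃ / (h : ℝ) ^ 2 := by
    intro h hh
    have hξ : N * h / (q * d : ℕ) ≠ 0 := by
      have : (h : ℝ) ≠ 0 := by exact_mod_cast hh
      positivity
    refine (Literature.NumberTheory.Sieve.FriedlanderIwaniecPrimes.norm_fourier_le_div hF hFc 2 hξ).trans ?_
    rw [div_le_div_iff₀ (by positivity) (by positivity)]
    have habs : |N * (h : ℝ) / (q * d : ℕ)| ^ 2 = N ^ 2 * (h : ℝ) ^ 2 / ((q * d : ℕ) : ℝ) ^ 2 := by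
      rw [sq_abs]; ring
    calc (∫ t, ‖iteratedDeriv 2 F t‖) * (h : ℝ) ^ 2 ≤ 2 * S * (C / δ ^ 2) * (h : ℝ) ^ 2 :=
          mul_le_mul_of_nonneg_right hL2 (sq_nonneg _)
      _ = B₃ * (2 * π * |N * (h : ℝ) / (q * d : ℕ)|) ^ 2 := by
          rw [mul_pow, habs, hB₃_def, hA_def]
          field_simp
  have hdom : ∀ h : ℤ, ‖𝓕 F (N * h / (q * d : ℕ)) * T h‖ ≤ g h := by
    intro h
    rw [norm_mul, hTnorm h]
    by_cases hh : h = 0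
    · simp only [hg_def, hh, if_true, Int.cast_zero, mul_zero, zero_div, zero_mul]
      refine mul_le_mul (hFour0 0) (norm_kloostermanSum_zero_left_le d c) (norm_nonneg _) hA0.le
    · simp only [hg_def, hh, if_false]
      have hK := norm_kloostermanSum_le_gcd_sqrt hqi_unit h c
      have hgcd1 : (1 : ℝ) ≤ ((Int.gcd h d : ℕ) : ℝ) := by
        exact_mod_cast Nat.gcd_pos_of_pos_right _ hd
      have hsqrt_gcd : Real.sqrt ((Int.gcd h d : ℕ) : ℝ) ≤ ((Int.gcd h d : ℕ) : ℝ) := by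
        rw [Real.sqrt_le_left (by linarith)]
        nlinarith
      have hmin : ‖𝓕 F (N * h / (q * d : ℕ))‖ ≤ min A (B₃ / (h : ℝ) ^ 2) :=
        le_min (hFour0 _) (hFour2 h hh)
      calc ‖𝓕 F (N * h / (q * d : ℕ))‖ * ‖kloostermanSum d ((h : ZMod d) * qi) c‖
          ≤ min A (B₃ / (h : ℝ) ^ 2) * (τd * Real.sqrt d * Real.sqrt ((Int.gcd h d : ℕ) : ℝ)) :=
            mul_le_mul hmin hK (norm_nonneg _) (le_min hA0.le (by positivity))
        _ ≤ min A (B₃ / (h : ℝ) ^ 2) * (τd * Real.sqrt d * ((Int.gcd h d : ℕ) : ℝ)) := by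
            refine mul_le_mul_of_nonneg_left ?_ (le_min hA0.le (by positivity))
            exact mul_le_mul_of_nonneg_left hsqrt_gcd (by positivity)
        _ = τd * Real.sqrt d * ((Int.gcd h d : ℕ) : ℝ) * min A (B₃ / (h : ℝ) ^ 2) := by ring
  -- the bound for finite partial sums of `g`
  set Bound : ℝ := A * (Nat.gcd c.val d : ℝ) + 2 * (τd * Real.sqrt d * (3 * τd * Real.sqrt (A * B₃)))
    with hBound
  have hpos_part : ∀ u : Finset ℤ, ∑ h ∈ u.filter (fun h : ℤ => 0 < h), g h ≤
      τd * Real.sqrt d * (3 * τd * Real.sqrt (A * B₃)) := by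
    intro u
    -- embed the positive part of `u` into `Icc 1 H`
    set H : ℕ := (u.sup fun h : ℤ => h.toNat) with hH
    have himg : ∑ h ∈ u.filter (fun h : ℤ => 0 < h), g h =
        ∑ n ∈ (u.filter (fun h : ℤ => 0 < h)).image Int.toNat, g (n : ℤ) := by
      rw [sum_image]
      · refine sum_congr rfl fun h hh => ?_
        rw [Int.toNat_of_nonneg (mem_filter.mp hh).2.le]
      · intro h₁ h₁m h₂ h₂m heq
        have e₁ := Int.toNat_of_nonneg (mem_filter.mp h₁m).2.le
        have e₂ := Int.toNat_of_nonneg (mem_filter.mp h₂m).2.le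
        rw [← e₁, ← e₂, heq]
    rw [himg]
    have hsub : (u.filter (fun h : ℤ => 0 < h)).image Int.toNat ⊆ Icc 1 H := by
      intro n hn
      obtain ⟨h, hh, rfl⟩ := mem_image.mp hn
      obtain ⟨hu, hpos⟩ := mem_filter.mp hh
      rw [mem_Icc]
      refine ⟨by omega, ?_⟩
      exact Finset.le_sup (f := fun h : ℤ => h.toNat) hu
    have hgn : ∀ n ∈ Icc 1 H, g (n : ℤ) = τd * Real.sqrt d * ((Nat.gcd n d : ℕ) : ℝ) * min A (B₃ / (n : ℝ) ^ 2) := by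
      intro n hn
      have hn0 : (n : ℤ) ≠ 0 := by have := (mem_Icc.mp hn).1; omega
      rw [hg_def]
      dsimp only
      rw [if_neg hn0, Int.gcd_natCast_natCast, Int.cast_natCast]
    calc ∑ n ∈ (u.filter (fun h : ℤ => 0 < h)).image Int.toNat, g (n : ℤ)
        ≤ ∑ n ∈ Icc 1 H, g (n : ℤ) := sum_le_sum_of_subset_of_nonneg hsub fun n _ _ => hg0 n
      _ = ∑ n ∈ Icc 1 H, τd * Real.sqrt d * (((Nat.gcd n d : ℕ) : ℝ) * min A (B₃ / (n : ℝ) ^ 2)) :=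
          sum_congr rfl fun n hn => by rw [hgn n hn]; ring
      _ = τd * Real.sqrt d * ∑ n ∈ Icc 1 H, ((Nat.gcd n d : ℕ) : ℝ) * min A (B₃ / (n : ℝ) ^ 2) := by
          rw [mul_sum]
      _ ≤ τd * Real.sqrt d * (3 * τd * Real.sqrt (A * B₃)) :=
          mul_le_mul_of_nonneg_left (sum_gcd_mul_min_le hA0.le hB₃0 hd.ne' H) (by positivity)
  have hneg_part : ∀ u : Finset ℤ, ∑ h ∈ u.filter (fun h : ℤ => h < 0), g h ≤
      τd * Real.sqrt d * (3 * τd * Real.sqrt (A * B₃)) := by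
    intro u
    -- reflect: `h ↦ -h`
    have hrefl : ∑ h ∈ u.filter (fun h : ℤ => h < 0), g h =
        ∑ h ∈ (u.filter (fun h : ℤ => h < 0)).image Neg.neg, g (-h) := by
      rw [sum_image (fun a _ b _ h => neg_injective h)]
      simp only [neg_neg]
    have hgneg : ∀ h : ℤ, g (-h) = g h := by
      intro h
      simp only [hg_def, neg_eq_zero, Int.cast_neg, neg_sq, Int.neg_gcd]
    rw [hrefl]
    simp only [hgneg]
    have := hpos_part ((u.filter (fun h : ℤ => h < 0)).image Neg.neg)
    refine le_trans (le_of_eq ?_) this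
    congr 1
    ext h
    simp only [mem_filter, mem_image]
    constructor
    · rintro ⟨h', ⟨hu, hneg⟩, rfl⟩
      exact ⟨⟨h', ⟨hu, hneg⟩, rfl⟩, by omega⟩
    · rintro ⟨hmem, _⟩
      exact hmem
  have hfin : ∀ u : Finset ℤ, ∑ h ∈ u, g h ≤ Bound := by
    intro u
    have hsplit : ∑ h ∈ u, g h = ∑ h ∈ u.filter (fun h : ℤ => h = 0), g h +
        (∑ h ∈ u.filter (fun h : ℤ => 0 < h), g h + ∑ h ∈ u.filter (fun h : ℤ => h < 0), g h) := by
      rw [← sum_filter_add_sum_filter_not u (fun h : ℤ => h = 0)]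
      congr 1
      rw [← sum_filter_add_sum_filter_not (u.filter (fun h : ℤ => ¬ h = 0)) (fun h : ℤ => 0 < h)]
      congr 1
      · congr 1; ext h; simp only [mem_filter]; constructor
        · rintro ⟨⟨hu, _⟩, hp⟩; exact ⟨hu, hp⟩
        · rintro ⟨hu, hp⟩; exact ⟨⟨hu, by omega⟩, hp⟩
      · congr 1; ext h; simp only [mem_filter, not_lt]; constructor
        · rintro ⟨⟨hu, hne⟩, hle⟩; exact ⟨hu, lt_of_le_of_ne hle hne⟩
        · rintro ⟨hu, hlt⟩; exact ⟨⟨hu, by omega⟩, hlt.le⟩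
    have h0 : ∑ h ∈ u.filter (fun h : ℤ => h = 0), g h ≤ A * (Nat.gcd c.val d : ℝ) := by
      have hsub : u.filter (fun h : ℤ => h = 0) ⊆ {0} := by
        intro h hh; rw [mem_singleton]; exact (mem_filter.mp hh).2
      calc ∑ h ∈ u.filter (fun h : ℤ => h = 0), g h ≤ ∑ h ∈ ({0} : Finset ℤ), g h :=
            sum_le_sum_of_subset_of_nonneg hsub fun h _ _ => hg0 h
        _ = A * (Nat.gcd c.val d : ℝ) := by simp [hg_def]
    rw [hsplit, hBound]
    linarith [hpos_part u, hneg_part u, h0]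
  -- summability and the norm of the series
  have hgsum : Summable g := summable_of_sum_le hg0 hfin
  have hseries : ‖∑' h : ℤ, 𝓕 F (N * h / (q * d : ℕ)) * T h‖ ≤ Bound :=
    (tsum_of_norm_bounded hgsum.hasSum hdom).trans (Real.tsum_le_of_sum_le hg0 hfin)
  -- evaluate `√(A B₃) = A √C (qd)/(2π δ N)`
  have hsqrt : Real.sqrt (A * B₃) = A * Real.sqrt C * ((q * d : ℕ) : ℝ) / (2 * π * δ * N) := by
    have hx : 0 ≤ A * Real.sqrt C * ((q * d : ℕ) : ℝ) / (2 * π * δ * N) := by positivity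
    rw [← Real.sqrt_sq hx]
    congr 1
    rw [div_pow, mul_pow, mul_pow, Real.sq_sqrt hC, hB₃_def]
    field_simp
  -- assemble
  have hnormN : ‖(N : ℂ) / ((q * d : ℕ) : ℂ)‖ = N / (q * d : ℕ) := by
    rw [norm_div, Complex.norm_real, Real.norm_eq_abs, abs_of_pos hN]
    simp
  rw [hnormN]
  set X : ℝ := τd ^ 2 * Real.sqrt d / δ with hX
  set Y : ℝ := N * (Nat.gcd c.val d : ℝ) / (d * q) with hY
  have hX0 : 0 ≤ X := by positivity
  have hY0 : 0 ≤ Y := by positivity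
  have hsC : 0 ≤ Real.sqrt C := Real.sqrt_nonneg C
  have hd0r : (0 : ℝ) < d := by exact_mod_cast hd
  have hq0r : (0 : ℝ) < q := by exact_mod_cast hq
  have hfinal : N / (q * d : ℕ) * Bound = 2 * S * Y + (6 / π) * (S * Real.sqrt C * X) := by
    rw [hBound, hsqrt, hA_def, hX, hY]
    push_cast
    field_simp
    ring
  have hπ : (6 : ℝ) / π ≤ 2 := by
    rw [div_le_iff₀ Real.pi_pos]; linarith [Real.pi_gt_three]
  calc N / (q * d : ℕ) * ‖∑' h : ℤ, 𝓕 F (N * h / (q * d : ℕ)) * T h‖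
      ≤ N / (q * d : ℕ) * Bound := mul_le_mul_of_nonneg_left hseries (by positivity)
    _ = 2 * S * Y + (6 / π) * (S * Real.sqrt C * X) := hfinal
    _ ≤ 2 * S * Y + 2 * (S * Real.sqrt C * X) := by
        have : 0 ≤ S * Real.sqrt C * X := by positivity
        nlinarith
    _ ≤ 2 * S * (1 + Real.sqrt C) * (X + Y) := by
        have e : 2 * S * (1 + Real.sqrt C) * (X + Y) - (2 * S * Y + 2 * (S * Real.sqrt C * X)) =
            2 * S * (X + Real.sqrt C * Y) := by ring
        have : 0 ≤ 2 * S * (X + Real.sqrt C * Y) := by positivity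
        linarith

/-- **Matomäki–Merikoski 2023, Lemma 3.8, as printed** (`≪_ε δ⁻¹ d^{1/2+ε} + N(d, c)/(dq)`): for
`ε > 0`, `S > 0`, `C ≥ 0` there is `K = K(ε, S, C)` such that for every smooth `F` with
`tsupport F ⊆ [-S, S]`, `|F| ≤ 1`, `|F''| ≤ C/δ²` (`δ > 0`), every `N > 0`, `d, q ≥ 1` with
`(q, d) = 1`, `α ∈ ℤ`, `c ∈ ℤ/d`:
`|∑_{m} F((α + qm)/N) 1_{(α+qm,d)=1} e_d(c (α+qm)‾)| ≤ K (δ⁻¹ d^{1/2+ε} + N (c, d)/(dq))`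
(from `MatomakiMerikoski2023_lemma38` and the divisor bound `τ(d)² ≤ C_{ε/2}² d^ε`,
`Literature.NumberTheory.Sieve.exists_card_divisors_le_mul_rpow`; the source's `c = k ē` has
`(d, c) = (d, k)`). [cite: MatomakiMerikoski2023, Lemma 3.8] -/
theorem MatomakiMerikoski2023_lemma38_rpow {ε : ℝ} (hε : 0 < ε) {S : ℝ} (hS : 0 < S) {C : ℝ}
    (hC : 0 ≤ C) :
    ∃ K : ℝ, 0 < K ∧ ∀ (F : ℝ → ℂ), ContDiff ℝ ∞ F → tsupport F ⊆ Set.Icc (-S) S →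
      (∀ x, ‖F x‖ ≤ 1) → ∀ δ : ℝ, 0 < δ → (∀ x, ‖iteratedDeriv 2 F x‖ ≤ C / δ ^ 2) →
      ∀ N : ℝ, 0 < N → ∀ (d q : ℕ) (hd : 0 < d), 0 < q → q.Coprime d → ∀ (α : ℤ) (c : ZMod d),
        ‖∑' m : ℤ, F ((α + q * m) / N) *
            (haveI : NeZero d := ⟨hd.ne'⟩
             if IsUnit ((α + q * m : ℤ) : ZMod d) then
                (ZMod.stdAddChar (c * ((α + q * m : ℤ) : ZMod d)⁻¹) : ℂ) else 0)‖ ≤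
          K * ((d : ℝ) ^ (1 / 2 + ε) / δ + N * Nat.gcd c.val d / (d * q)) := by
  obtain ⟨Cτ, hCτ1, hCτ⟩ := Literature.NumberTheory.Sieve.exists_card_divisors_le_mul_rpow
    (half_pos hε)
  refine ⟨2 * S * (1 + Real.sqrt C) * Cτ ^ 2, by positivity, ?_⟩
  intro F hF hsupp hF1 δ hδ hF2 N hN d q hd hq hqd α c
  have hmain := MatomakiMerikoski2023_lemma38 hF hS hsupp hF1 hC hδ hF2 hN hd hq hqd α c
  refine hmain.trans ?_
  have hd0 : (0 : ℝ) < d := by exact_mod_cast hd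
  have hτ : (#d.divisors : ℝ) ≤ Cτ * (d : ℝ) ^ (ε / 2) := hCτ d hd.ne'
  have hτ0 : (0 : ℝ) ≤ #d.divisors := Nat.cast_nonneg _
  -- `τ(d)² √d ≤ Cτ² d^ε √d = Cτ² d^{1/2+ε}`
  have hpow : (#d.divisors : ℝ) ^ 2 * Real.sqrt d ≤ Cτ ^ 2 * (d : ℝ) ^ (1 / 2 + ε) := by
    have h1 : (#d.divisors : ℝ) ^ 2 ≤ (Cτ * (d : ℝ) ^ (ε / 2)) ^ 2 := pow_le_pow_left₀ hτ0 hτ 2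
    have h2 : (Cτ * (d : ℝ) ^ (ε / 2)) ^ 2 * Real.sqrt d = Cτ ^ 2 * (d : ℝ) ^ (1 / 2 + ε) := by
      rw [mul_pow, ← Real.rpow_natCast ((d : ℝ) ^ (ε / 2)) 2, ← Real.rpow_mul hd0.le,
        Real.sqrt_eq_rpow, mul_assoc, ← Real.rpow_add hd0]
      congr 2
      push_cast
      ring
    calc (#d.divisors : ℝ) ^ 2 * Real.sqrt d ≤ (Cτ * (d : ℝ) ^ (ε / 2)) ^ 2 * Real.sqrt d :=
          mul_le_mul_of_nonneg_right h1 (Real.sqrt_nonneg _)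
      _ = Cτ ^ 2 * (d : ℝ) ^ (1 / 2 + ε) := h2
  have hX : (#d.divisors : ℝ) ^ 2 * Real.sqrt d / δ ≤ Cτ ^ 2 * ((d : ℝ) ^ (1 / 2 + ε) / δ) := by
    rw [mul_div_assoc']
    exact div_le_div_of_nonneg_right hpow hδ.le
  have hY : N * (Nat.gcd c.val d : ℝ) / (d * q) ≤ Cτ ^ 2 * (N * Nat.gcd c.val d / (d * q)) := by
    have h0 : 0 ≤ N * (Nat.gcd c.val d : ℝ) / (d * q) := by positivity
    have h1 : (1 : ℝ) ≤ Cτ ^ 2 := one_le_pow₀ hCτ1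
    nlinarith
  have h2S : 0 ≤ 2 * S * (1 + Real.sqrt C) := by positivity
  calc 2 * S * (1 + Real.sqrt C) *
        ((#d.divisors : ℝ) ^ 2 * Real.sqrt d / δ + N * Nat.gcd c.val d / (d * q))
      ≤ 2 * S * (1 + Real.sqrt C) *
        (Cτ ^ 2 * ((d : ℝ) ^ (1 / 2 + ε) / δ) + Cτ ^ 2 * (N * Nat.gcd c.val d / (d * q))) :=
        mul_le_mul_of_nonneg_left (add_le_add hX hY) h2S
    _ = 2 * S * (1 + Real.sqrt C) * Cτ ^ 2 * ((d : ℝ) ^ (1 / 2 + ε) / δ + N * Nat.gcd c.val d / (d * q)) := by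
        ring

end Literature.NumberTheory.LFunctions.MatomakiMerikoski
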